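import Summits.ValiantsHypothesis.ValiantsHypothesis.Theorems.LacunarySymmetroidMatrixDescartesPivotDefiniteGraded

/-!
# `MatrixDescartes` (stmt-ValiantsHypothesis-18050) — RANK-ONE letters against an NSD pivot, EVERY size:
# the SET-graded Descartes bound `Z₊ ≤ 2·∑_{j odd ≤ min r m} C(K, m − j)` (polynomial of degree `m − 1` in `K`)

HONEST FRAMING.  Cell `pub-symmetroid`, seat `val-sym-mdr-p2` (gen 27); helper file `--supports` the crux
`Theses.LacunarySymmetroid.MatrixDescartes` (OPEN), NO closure claim.  Companion of gen 26's `…PivotDefiniteGraded` (`negSemidef_pivot_graded`: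
`J = −WWᵀ`, PSD letters ⇒ `Z₊ ≤ 2·∑_{j odd ≤ min r m} C(K + m − j − 1, K − 1)`, the odd levels indexed by MULTISETS of letters) for the
rank-one sector: when every letter is a rank-one square `Pₖ = vₖvₖᵀ`, each letter owns ONE Gram column, a Cauchy–Binet selection uses each
letter at most once, and the odd levels are indexed by SUBSETS:

* `pencil_eq_gram_rankOne` — `X^e(−WWᵀ) + ∑ₖ X^{dₖ} vₖvₖᵀ` is the signed Gram pencil of the pool `Fin K ⊕ Fin r` (columns `vₖ` with sign `+`
  at exponent `dₖ`, columns of `W` with sign `−` at exponent `e`);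
* **`rankOne_negSemidef_graded`**: `Z₊ ≤ 2·∑_{j odd, j ≤ min r m} C(K, m − j)` for every size `m`, every `K`, every `W` (`m × r`), every
  exponents and vectors.  At `m = 2` this is the tree's `2K` (`Pivot.DefinitePivot`); at `m = 3` with `r ≥ 3` it is `K(K − 1) + 2`
  (`rankOne_negSemidef_three`), e.g. `14` at `K = 4` where gen 26's multiset count gives `22` and the size-free low-rank ceiling
  `∏(rank + 1) − 1 = 2^K − 1` (`…LowRankSector`, pivot of any rank) gives `15`; for fixed `m` the bound is a polynomial of degree `m − 1` in `K`
  with leading term `2K^{m−1}/(m−1)!`, against the low-rank sector's `2^K`.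
The proof is gen 26's parity bookkeeping on the smaller pool (a selection with an odd number `j` of `W`-columns has exponent `j·e + ∑_{k ∈ S} dₖ`
for the SET `S` of the `m − j` letters it uses).  Nothing here bears on `MatrixDescartes` in its window, on `stub_twoSided`, on `DoorA26` /
`DoorA34`, on the cell's registers, or on `VP ≠ VNP`.

[folklore] Cauchy–Binet for signed Gram pencils (`Pivot.GramExpansion.coeff_det_gramPencil`, gen 3) + Descartes with a negative-support budget
(`Pivot.TwoDescartes.card_posRoots_le_two_mul_card`); no definitions, no named facts.
-/

-- `Summit.ValiantsHypothesis.ValiantsHypothesis.…` repeats a component by the D-0017 layout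
-- (single-conjunct summit), which the `dupNamespace` linter flags; the name is mandated.
set_option linter.dupNamespace false

namespace Summit.ValiantsHypothesis.ValiantsHypothesis.Theorems.LacunarySymmetroidMatrixDescartes.Pivot.NsdRankOneGraded

open Polynomial Matrix Finset
open scoped BigOperators

variable {m K q : ℕ}

/-! ## 1. The signed Gram form of the rank-one pencil on the pool `Fin K ⊕ Fin q` -/

/-- **Gram form, rank-one letters.**  With the pool `σ = Fin K ⊕ Fin q` re-indexed by `ε : σ ≃ Fin N`: columns `vₖ` (sign `+`, exponent `dₖ`)
and the columns of `W` (sign `−`, exponent `e`). [folklore] -/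
theorem pencil_eq_gram_rankOne (e : ℕ) (d : Fin K → ℕ) (W : Matrix (Fin m) (Fin q) ℝ) (v : Fin K → Fin m → ℝ)
    (ε : (Fin K ⊕ Fin q) ≃ Fin (Fintype.card (Fin K ⊕ Fin q))) :
    ((X : ℝ[X]) ^ e) • (-(W * Wᵀ)).map Polynomial.C + ∑ k, ((X : ℝ[X]) ^ d k) • (Matrix.vecMulVec (v k) (v k)).map Polynomial.C
      = ∑ j, (Polynomial.C ((Sum.elim (fun _ => (1 : ℝ)) (fun _ => -1)) (ε.symm j))
          * (X : ℝ[X]) ^ ((Sum.elim d (fun _ => e)) (ε.symm j)))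
        • (Matrix.vecMulVec ((Sum.elim v (fun c => fun i => W i c)) (ε.symm j))
            ((Sum.elim v (fun c => fun i => W i c)) (ε.symm j))).map Polynomial.C := by
  refine Matrix.ext fun i i' => ?_
  have hR : (∑ j, (Polynomial.C ((Sum.elim (fun _ => (1 : ℝ)) (fun _ => -1)) (ε.symm j))
          * (X : ℝ[X]) ^ ((Sum.elim d (fun _ => e)) (ε.symm j)))
        • (Matrix.vecMulVec ((Sum.elim v (fun c => fun i => W i c)) (ε.symm j))
            ((Sum.elim v (fun c => fun i => W i c)) (ε.symm j))).map Polynomial.C) i i'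
      = ∑ x : Fin K ⊕ Fin q, Polynomial.C ((Sum.elim (fun _ => (1 : ℝ)) (fun _ => -1)) x)
            * (X : ℝ[X]) ^ ((Sum.elim d (fun _ => e)) x)
            * Polynomial.C (((Sum.elim v (fun c => fun i => W i c)) x) i * ((Sum.elim v (fun c => fun i => W i c)) x) i') := by
    rw [Matrix.sum_apply]
    simp only [Matrix.smul_apply, Matrix.map_apply, Matrix.vecMulVec_apply, smul_eq_mul]
    exact Equiv.sum_comp ε.symm (fun x => Polynomial.C ((Sum.elim (fun _ => (1 : ℝ)) (fun _ => -1)) x)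
      * (X : ℝ[X]) ^ ((Sum.elim d (fun _ => e)) x)
      * Polynomial.C (((Sum.elim v (fun c => fun i => W i c)) x) i * ((Sum.elim v (fun c => fun i => W i c)) x) i'))
  rw [hR, Fintype.sum_sum_type]
  simp only [Sum.elim_inl, Sum.elim_inr, map_one, one_mul, Matrix.add_apply, Matrix.smul_apply, Matrix.map_apply,
    Matrix.sum_apply, Matrix.vecMulVec_apply, smul_eq_mul, Matrix.neg_apply]
  have hW : ∑ c : Fin q, Polynomial.C (-1 : ℝ) * (X : ℝ[X]) ^ e * Polynomial.C (W i c * W i' c)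
      = (X : ℝ[X]) ^ e * Polynomial.C (-((W * Wᵀ) i i')) := by
    rw [Matrix.mul_apply, ← Finset.sum_neg_distrib, map_sum, Finset.mul_sum]
    refine Finset.sum_congr rfl fun c _ => ?_
    rw [Matrix.transpose_apply, map_neg, map_neg, map_one]; ring
  rw [hW, add_comm]

/-! ## 2. The set-graded count -/

/-- The odd-level SET exponents: `j·e + ∑_{k ∈ S} dₖ` for `j` odd, `j ≤ min q m`, `S ⊆ Fin K` with `#S = m − j`; their number is at most
`∑_{j odd ≤ min q m} C(K, m − j)`. [folklore] -/
theorem card_oddSubsetImage_le (e : ℕ) (d : Fin K → ℕ) (m q : ℕ) :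
    (((Finset.range (min q m + 1)).filter (fun j => Odd j)).biUnion
        (fun j => ((Finset.univ : Finset (Fin K)).powersetCard (m - j)).image (fun S => j * e + ∑ k ∈ S, d k))).card
      ≤ ((Finset.range (min q m + 1)).filter (fun j => Odd j)).sum (fun j => Nat.choose K (m - j)) := by
  refine Finset.card_biUnion_le.trans (Finset.sum_le_sum fun j _ => ?_)
  calc _ ≤ ((Finset.univ : Finset (Fin K)).powersetCard (m - j)).card := Finset.card_image_le
    _ = Nat.choose K (m - j) := by rw [Finset.card_powersetCard, Finset.card_univ, Fintype.card_fin]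

/-- **RANK-ONE LETTERS AGAINST AN NSD PIVOT, EVERY SIZE.**  For `J = −WWᵀ` (`W` real `m × r`) and rank-one letters `Pₖ = vₖvₖᵀ`:
`Z₊ ≤ 2·∑_{j odd, j ≤ min r m} C(K, m − j)` (`K ≥ 1`). [folklore] -/
theorem rankOne_negSemidef_graded (e : ℕ) (d : Fin K → ℕ) (W : Matrix (Fin m) (Fin q) ℝ) (v : Fin K → Fin m → ℝ)
    (hK : 0 < K) :
    pivotPosRoots e d (-(W * Wᵀ)) (fun k => Matrix.vecMulVec (v k) (v k))
      ≤ 2 * ((Finset.range (min q m + 1)).filter (fun j => Odd j)).sum (fun j => Nat.choose K (m - j)) := by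
  classical
  haveI : Nonempty (Fin K) := ⟨⟨0, hK⟩⟩
  unfold pivotPosRoots
  set σ := Fin K ⊕ Fin q with hσ
  set ε : σ ≃ Fin (Fintype.card σ) := Fintype.equivFin σ with hε
  set sgσ : σ → ℝ := Sum.elim (fun _ => (1 : ℝ)) (fun _ => -1) with hsg
  set exσ : σ → ℕ := Sum.elim d (fun _ => e) with hex
  set colσ : σ → Fin m → ℝ := Sum.elim v (fun c => fun i => W i c) with hcol
  rw [pencil_eq_gram_rankOne e d W v ε]
  set T : Finset ℕ := ((Finset.range (min q m + 1)).filter (fun j => Odd j)).biUnion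
      (fun j => ((Finset.univ : Finset (Fin K)).powersetCard (m - j)).image (fun S => j * e + ∑ k ∈ S, d k)) with hT
  refine (TwoDescartes.card_posRoots_le_two_mul_card _ T fun n hn => ?_).trans
    (Nat.mul_le_mul_left 2 (card_oddSubsetImage_le e d m q))
  by_contra hnT
  refine absurd hn (not_lt.2 ?_)
  rw [GramExpansion.coeff_det_gramPencil]
  refine Finset.sum_nonneg fun t ht => ?_
  have htinj : Function.Injective t := (Finset.mem_filter.1 ht).2.injective
  split_ifs with hsum
  swap
  · exact le_rfl
  -- rows selecting a (negative) column of `W`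
  set A : Finset (Fin m) := Finset.univ.filter (fun a => ∃ c, ε.symm (t a) = Sum.inr c) with hA
  have hsign : ∏ a, sgσ (ε.symm (t a)) = (-1 : ℝ) ^ A.card := by
    rw [← Finset.prod_filter_mul_prod_filter_not Finset.univ (fun a => ∃ c, ε.symm (t a) = Sum.inr c), ← hA]
    have h1 : ∏ a ∈ A, sgσ (ε.symm (t a)) = (-1 : ℝ) ^ A.card := by
      rw [← Finset.prod_const]
      refine Finset.prod_congr rfl fun a ha => ?_
      obtain ⟨c, hc⟩ := (Finset.mem_filter.mp (hA ▸ ha)).2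
      rw [hc, hsg, Sum.elim_inr]
    have h2 : ∏ a ∈ Finset.univ.filter (fun a => ¬ ∃ c, ε.symm (t a) = Sum.inr c), sgσ (ε.symm (t a)) = 1 := by
      refine Finset.prod_eq_one fun a ha => ?_
      have hno := (Finset.mem_filter.mp ha).2
      rcases hx : ε.symm (t a) with k | c
      · rw [hsg, Sum.elim_inl]
      · exact absurd ⟨c, hx⟩ hno
    rw [h1, h2, mul_one]
  by_cases hpar : Even A.card
  · change 0 ≤ (∏ a, sgσ (ε.symm (t a))) * _
    rw [hsign, hpar.neg_one_pow, one_mul]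
    exact sq_nonneg _
  · exfalso
    have hodd : Odd A.card := Nat.not_even_iff_odd.mp hpar
    -- the other rows select letter columns, pairwise distinct letters
    have hother : ∀ a, a ∉ A → ∃ k : Fin K, ε.symm (t a) = Sum.inl k := by
      intro a ha
      rcases hx : ε.symm (t a) with k | c
      · exact ⟨k, rfl⟩
      · exact absurd (Finset.mem_filter.mpr ⟨Finset.mem_univ _, ⟨c, hx⟩⟩) (hA ▸ ha)
    choose! kk hkk using hother
    have hinjσ : ∀ a b, ε.symm (t a) = ε.symm (t b) → a = b := fun a b h => htinj (ε.symm.injective h)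
    set S : Finset (Fin K) := (Finset.univ \ A).image kk with hS
    have hkinj : Set.InjOn kk ↑(Finset.univ \ A) := by
      intro a ha b hb hab
      have ha' : a ∉ A := (Finset.mem_sdiff.mp (Finset.mem_coe.mp ha)).2
      have hb' : b ∉ A := (Finset.mem_sdiff.mp (Finset.mem_coe.mp hb)).2
      exact hinjσ a b (by rw [hkk a ha', hkk b hb', hab])
    have hScard : S.card = m - A.card := by
      rw [hS, Finset.card_image_of_injOn hkinj, Finset.card_sdiff, Finset.inter_univ, Finset.card_univ, Fintype.card_fin]
    have hAq : A.card ≤ q := by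
      rcases Nat.eq_zero_or_pos q with hq0 | hq0
      · subst hq0
        have : A = ∅ := by
          rw [Finset.eq_empty_iff_forall_notMem]
          intro a ha
          obtain ⟨c, _⟩ := (Finset.mem_filter.mp (hA ▸ ha)).2
          exact Fin.elim0 c
        rw [this, Finset.card_empty]
      · let col : Fin m → Fin q := fun a => (ε.symm (t a)).elim (fun _ => ⟨0, hq0⟩) id
        have : A.card ≤ (Finset.univ : Finset (Fin q)).card := by
          refine Finset.card_le_card_of_injOn col (fun _ _ => Finset.mem_univ _) ?_
          intro a ha b hb hab
          obtain ⟨ca, hca⟩ := (Finset.mem_filter.mp (hA ▸ Finset.mem_coe.mp ha)).2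
          obtain ⟨cb, hcb⟩ := (Finset.mem_filter.mp (hA ▸ Finset.mem_coe.mp hb)).2
          have hc : ca = cb := by simpa [col, hca, hcb] using hab
          exact hinjσ a b (by rw [hca, hcb, hc])
        simpa using this
    have hAm : A.card ≤ m := (Finset.card_le_univ A).trans (by rw [Fintype.card_fin])
    apply hnT
    rw [hT]
    refine Finset.mem_biUnion.mpr ⟨A.card, Finset.mem_filter.mpr ⟨Finset.mem_range.mpr ?_, hodd⟩, ?_⟩
    · have := Nat.le_min.mpr ⟨hAq, hAm⟩; omega
    refine Finset.mem_image.mpr ⟨S, Finset.mem_powersetCard.mpr ⟨Finset.subset_univ _, hScard⟩, ?_⟩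
    rw [hsum, ← Finset.sum_filter_add_sum_filter_not Finset.univ (fun a => ∃ c, ε.symm (t a) = Sum.inr c), ← hA]
    have hneg : ∑ a ∈ A, exσ (ε.symm (t a)) = A.card * e := by
      rw [Finset.sum_const_nat fun a ha => ?_]
      obtain ⟨c, hc⟩ := (Finset.mem_filter.mp (hA ▸ ha)).2
      rw [hc, hex, Sum.elim_inr]
    have hset : Finset.univ.filter (fun a => ¬ ∃ c, ε.symm (t a) = Sum.inr c) = Finset.univ \ A := by
      ext a; simp [hA]
    have hpos : ∑ a ∈ Finset.univ.filter (fun a => ¬ ∃ c, ε.symm (t a) = Sum.inr c), exσ (ε.symm (t a)) = ∑ k ∈ S, d k := by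
      rw [hset, hS, Finset.sum_image hkinj]
      refine Finset.sum_congr rfl fun a ha => ?_
      have ha' : a ∉ A := (Finset.mem_sdiff.mp ha).2
      rw [hkk a ha', hex, Sum.elim_inl]
    change (A.card * e + ∑ k ∈ S, d k) = _
    rw [hneg, hpos]

/-! ## 3. Instances -/

/-- `m = 3`, `J` NEGATIVE (SEMI)DEFINITE given as `−WWᵀ` with `W` square: rank-one letters ⇒ `Z₊ ≤ K(K − 1) + 2`
(`2·(C(K,2) + C(K,0))`; e.g. `14` at `K = 4`, against the low-rank ceiling `15` and gen 26's multiset count `22`). [folklore] -/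
theorem rankOne_negSemidef_three (e : ℕ) (d : Fin K → ℕ) (W : Matrix (Fin 3) (Fin 3) ℝ) (v : Fin K → Fin 3 → ℝ)
    (hK : 0 < K) :
    pivotPosRoots e d (-(W * Wᵀ)) (fun k => Matrix.vecMulVec (v k) (v k)) ≤ K * (K - 1) + 2 := by
  refine (rankOne_negSemidef_graded e d W v hK).trans ?_
  rw [show min 3 3 + 1 = 4 by rfl, Finset.sum_filter, Finset.sum_range_succ, Finset.sum_range_succ, Finset.sum_range_succ,
    Finset.sum_range_succ, Finset.sum_range_zero]
  simp only [Nat.odd_iff]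
  norm_num [Nat.choose_two_right, Nat.choose_zero_right]
  rcases Nat.even_or_odd K with ⟨k, hk⟩ | ⟨k, hk⟩ <;> subst hk <;> ring_nf <;> omega

/-- The same for a NEGATIVE-SEMIDEFINITE pivot letter `J` given as such (`−J ⪰ 0`), size `3`. [folklore] -/
theorem rankOne_negSemidef_three' (e : ℕ) (d : Fin K → ℕ) (J : Matrix (Fin 3) (Fin 3) ℝ) (hJ : (-J).PosSemidef)
    (v : Fin K → Fin 3 → ℝ) (hK : 0 < K) :
    pivotPosRoots e d J (fun k => Matrix.vecMulVec (v k) (v k)) ≤ K * (K - 1) + 2 := by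
  obtain ⟨W, hW⟩ := ResolventDescartes.exists_eq_mul_transpose (-J) hJ
  have hJ' : J = -(W * Wᵀ) := by rw [← hW, neg_neg]
  rw [hJ']
  exact rankOne_negSemidef_three e d W v hK

end Summit.ValiantsHypothesis.ValiantsHypothesis.Theorems.LacunarySymmetroidMatrixDescartes.Pivot.NsdRankOneGraded
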